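import Literature.Computability.AlgebraicComplexity.PartialMatrixMultiplicationProofs
import Literature.Computability.AlgebraicComplexity.AsymptoticRankMatMul
import HarnessLib

/-!
# Schönhage's partial matrix multiplication theorem for the ASYMPTOTIC RANK

Solo-informed seat (gen 30), paper §2q, part 1 of 3 (then `SoloInformedTriangularDoor.lean`,
`SoloInformedTTwoDoor.lean`).  Everything here is PROVED — no named fact is assumed: the tree
DISCHARGES Schönhage's theorem (`Schonhage1981_partialMatMul_holds`, BCS Thm. (15.48):
`bR(⟨e,h,l⟩_{I,J}) ≤ r ⇒ f^{ω/3} ≤ r`, `f = #{(i,j,k) : (i,j) ∈ I, (j,k) ∈ J}` the filling).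

* `filling_rpow_le_asymptoticRank` — **`f^{ω(K)/3} ≤ R̃(⟨e,h,l⟩_{I,J})`** over every infinite
  field: the `N`-th power of a partial matrix multiplication restricts to (in fact is) the
  partial matrix multiplication of the power pattern `(I^N, J^N)` on `[e^N] × [h^N]`, `[h^N] × [l^N]`
  (notation `powPat[I, N]`, `tensorRestrictsTo_kroneckerPow_partialMatMulTensor`; BCS (15.46)), whose filling
  is `f^N` (`filling_powPattern`), so the rank form of Thm. (15.48) gives `(f^{ω/3})^N ≤ R(t^{⊗N})`
  for every `N`, and `R̃(t) = inf_N R(t^{⊗N})^{1/N}` (`le_asymptoticRank_of_pow_le`).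
* `omega_le_three_mul_logb_of_asymptoticRank_le` — log form: `f ≥ 2`, `R̃ ≤ ρ ⇒ ω ≤ 3 log_f ρ`.
* `tensorRestrictsTo_matMulTensor_partialMatMulTensor`, `asymptoticRank_partialMatMulTensor_le_rpow_omega`
  — the pattern is a restriction of the total product, so `R̃(⟨k,k,k⟩_{I,J}) ≤ R̃(⟨k,k,k⟩) = k^ω`.
* `card_le_asymptoticRank_of_dualPairsOn` — dual pairs on a SUBSET `S` of the slice indices give
  `|S| ≤ ζ⁽¹⁾(t) ≤ R̃(t)` (the flattening lower bound for zero-padded tensors such as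
  `⟨e,h,l⟩_{I,J}`).

## References

* [BurgisserClausenShokrollahi1997] P. Bürgisser, M. Clausen, M. A. Shokrollahi, *Algebraic
  Complexity Theory*, Springer 1997, §15.9: (15.46), Lemma (15.47), Thm. (15.48), Ex. (15.50)
  (pp. 407–410, held, read); Ex. 17.23(4) (`T₂`).
* [Schonhage1981] A. Schönhage, *Partial and total matrix multiplication*, SIAM J. Comput. 10
  (1981) 434–455, Thm. 4.1.
* [AlmanDuanVassilevskaWilliamsXuXuZhou2025] J. Alman et al., SODA 2025 = arXiv:2404.16349, §3.4
  (`R̃(⟨q,q,q⟩) = q^ω`); the record `ω < 2.371339`.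
* [ChristandlVranaZuiddam2023] M. Christandl, P. Vrana, J. Zuiddam, *Universal points in the
  asymptotic spectrum of tensors*, J. AMS 36 (2023), §1.1 (`R̃`), Example 1.4 (flattening ranks).
* [Blaser2013] M. Bläser, *Fast Matrix Multiplication*, ToC Graduate Surveys 5 (2013), Lemma 5.4,
  Lemma 7.1.
* [Alman2021] J. Alman, Theory of Computing 17 (2021), §2.4 (`R̃` is monotone under degeneration).
-/

noncomputable section

open scoped BigOperators

namespace Summit.MatrixMultiplication.MatrixMultiplication.Theorems

open Literature.Computability.AlgebraicComplexity
open Literature.Barriers.MatrixMultiplication (asymptoticRank_le_of_polyDegeneratesTo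
  flatteningRank_le_asymptoticRank)

/-! ## Lower bounds on all powers bound the asymptotic rank -/

section PowLe

variable {K : Type*} [Field K] {ι κ μ : Type*} [Fintype ι] [Fintype κ] [Fintype μ]

/-- If `c^N ≤ R(t^{⊗N})` for every `N ≥ 1` then `c ≤ R̃(t)` (definition of `R̃` as the infimum of
`R(t^{⊗N})^{1/N}`). [cite: ChristandlVranaZuiddam2023, §1.1] -/
theorem le_asymptoticRank_of_pow_le (t : ι → κ → μ → K) {c : ℝ} (hc : 0 ≤ c)
    (h : ∀ N : ℕ, c ^ (N + 1) ≤ (tensorRank (kroneckerPow t (N + 1)) : ℝ)) :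
    c ≤ asymptoticRank t := by
  refine le_ciInf fun N => ?_
  have hexp : ((N : ℝ) + 1)⁻¹ = (((N + 1 : ℕ) : ℝ))⁻¹ := by push_cast; ring
  calc c = (c ^ (N + 1)) ^ ((N : ℝ) + 1)⁻¹ := by
        rw [hexp, Real.pow_rpow_inv_natCast hc (Nat.succ_ne_zero N)]
    _ ≤ (tensorRank (kroneckerPow t (N + 1)) : ℝ) ^ ((N : ℝ) + 1)⁻¹ :=
        Real.rpow_le_rpow (by positivity) (h N) (by positivity)

end PowLe

/-! ## Powers of a pattern -/

/- The `N`-th power `I^N` of a pattern `I ⊆ [e] × [h]`, as a pattern on `[e^N] × [h^N]` (read the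
two coordinates as words via `finFunctionFinEquiv`): `(u, v) ∈ I^N ⟺ ∀ s, (u_s, v_s) ∈ I`.
A NOTATION `powPat[I, N]` (no new definition). [cite: BurgisserClausenShokrollahi1997, (15.46)] -/
set_option quotPrecheck false in
local notation "powPat[" I ", " N "]" => (Finset.univ.filter fun q =>
    ∀ s : Fin N, (finFunctionFinEquiv.symm q.1 s, finFunctionFinEquiv.symm q.2 s) ∈ I)

section PowPattern


variable (K : Type*) [Field K]

/-- **`(⟨e,h,l⟩_{I,J})^{⊗N} ≥ ⟨e^N, h^N, l^N⟩_{I^N, J^N}`** (in fact `≅`; BCS (15.46)): the power of a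
partial matrix multiplication restricts to the partial matrix multiplication of the power pattern.
[cite: BurgisserClausenShokrollahi1997, (15.46)] -/
theorem tensorRestrictsTo_kroneckerPow_partialMatMulTensor (e h l : ℕ)
    (I : Finset (Fin e × Fin h)) (J : Finset (Fin h × Fin l)) (N : ℕ) :
    TensorRestrictsTo (kroneckerPow (partialMatMulTensor K e h l I J) N)
      (partialMatMulTensor K (e ^ N) (h ^ N) (l ^ N) (powPat[I, N]) (powPat[J, N])) := by
  classical
  set Fe : (Fin N → Fin e) ≃ Fin (e ^ N) := finFunctionFinEquiv with hFe
  set Fh : (Fin N → Fin h) ≃ Fin (h ^ N) := finFunctionFinEquiv with hFh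
  set Fl : (Fin N → Fin l) ≃ Fin (l ^ N) := finFunctionFinEquiv with hFl
  have h1 := tensorRestrictsTo_precomp (kroneckerPow (partialMatMulTensor K e h l I J) N)
      (fun a : Fin (e ^ N) × Fin (l ^ N) => fun s => (Fe.symm a.1 s, Fl.symm a.2 s))
      (fun b : Fin (e ^ N) × Fin (h ^ N) => fun s => (Fe.symm b.1 s, Fh.symm b.2 s))
      (fun c : Fin (h ^ N) × Fin (l ^ N) => fun s => (Fh.symm c.1 s, Fl.symm c.2 s))
  convert h1 using 1
  funext a b c
  rw [partialMatMulTensor_apply]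
  have hz := kroneckerPow_partialMatMulTensor_zip K e h l I J N (Fe.symm a.1, Fl.symm a.2)
    (Fe.symm b.1, Fh.symm b.2) (Fh.symm c.1, Fl.symm c.2)
  dsimp only at hz ⊢
  rw [hz]
  refine ite_congr_prop ?_
  simp only [Finset.mem_filter, Finset.mem_univ, true_and, hFe, hFh, hFl,
    Equiv.apply_eq_iff_eq]

/-- **The filling of the power pattern is `f^N`.** [cite: BurgisserClausenShokrollahi1997, Thm. (15.48) (proof)] -/
theorem filling_powPattern (e h l : ℕ) (I : Finset (Fin e × Fin h)) (J : Finset (Fin h × Fin l))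
    (N : ℕ) :
    filling (e ^ N) (h ^ N) (l ^ N) (powPat[I, N]) (powPat[J, N]) = filling e h l I J ^ N := by
  classical
  -- the triple count on words, as a product
  have hprod := card_filter_forall_eq_prod_card
    (fun (_ : Fin N) (p : Fin e × Fin h × Fin l) => (p.1, p.2.1) ∈ I ∧ (p.2.1, p.2.2) ∈ J)
  rw [Finset.prod_const, Finset.card_univ, Fintype.card_fin] at hprod
  unfold filling
  rw [← hprod]
  -- transport along the word equivalence
  let E : Fin (e ^ N) × Fin (h ^ N) × Fin (l ^ N) ≃ (Fin N → Fin e × Fin h × Fin l) :=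
    { toFun := fun q s => (finFunctionFinEquiv.symm q.1 s, finFunctionFinEquiv.symm q.2.1 s,
        finFunctionFinEquiv.symm q.2.2 s)
      invFun := fun w => (finFunctionFinEquiv (fun s => (w s).1),
        finFunctionFinEquiv (fun s => (w s).2.1), finFunctionFinEquiv (fun s => (w s).2.2))
      left_inv := fun q => by simp
      right_inv := fun w => by funext s; simp }
  refine Finset.card_equiv E fun q => ?_
  simp only [Finset.mem_filter, Finset.mem_univ, true_and, E, Equiv.coe_fn_mk, forall_and]

end PowPattern

/-! ## Schönhage's theorem for the asymptotic rank -/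

section Asymptotic

variable (K : Type) [Field K] [Infinite K]

/-- **Schönhage's partial matrix multiplication theorem, asymptotic-rank form:
`f^{ω/3} ≤ R̃(⟨e,h,l⟩_{I,J})`**, `f` the filling — apply the border-rank form (BCS Thm. (15.48),
tree `Schonhage1981_partialMatMul_holds`) to the `N`-th power, a partial matrix multiplication of
filling `f^N`: `(f^N)^{ω/3} ≤ R((⟨e,h,l⟩_{I,J})^{⊗N})` for every `N`.
[cite: BurgisserClausenShokrollahi1997, Thm. (15.48)] -/
theorem filling_rpow_le_asymptoticRank (e h l : ℕ) (I : Finset (Fin e × Fin h))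
    (J : Finset (Fin h × Fin l)) :
    (filling e h l I J : ℝ) ^ (omega K / 3) ≤ asymptoticRank (partialMatMulTensor K e h l I J) := by
  refine le_asymptoticRank_of_pow_le _ (by positivity) fun N => ?_
  have hS := Schonhage1981_partialMatMul_holds.rank_form K (e ^ (N + 1)) (h ^ (N + 1))
    (l ^ (N + 1)) (powPat[I, N + 1]) (powPat[J, N + 1])
  rw [filling_powPattern] at hS
  have hres := (tensorRestrictsTo_kroneckerPow_partialMatMulTensor K e h l I J (N + 1)).tensorRank_le
  have hf0 : (0 : ℝ) ≤ filling e h l I J := Nat.cast_nonneg _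
  calc ((filling e h l I J : ℝ) ^ (omega K / 3)) ^ (N + 1)
      = (((filling e h l I J ^ (N + 1) : ℕ)) : ℝ) ^ (omega K / 3) := by
        rw [← Real.rpow_natCast, ← Real.rpow_mul hf0, mul_comm, Real.rpow_mul hf0,
          Real.rpow_natCast, Nat.cast_pow]
    _ ≤ tensorRank (partialMatMulTensor K (e ^ (N + 1)) (h ^ (N + 1)) (l ^ (N + 1))
          (powPat[I, N + 1]) (powPat[J, N + 1])) := hS
    _ ≤ _ := by exact_mod_cast hres

/-- **Logarithmic form**: `f ≥ 2`, `R̃(⟨e,h,l⟩_{I,J}) ≤ ρ` `⇒ ω ≤ 3 log_f ρ`.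
[cite: BurgisserClausenShokrollahi1997, Thm. (15.48) and Ex. (15.50)] -/
theorem omega_le_three_mul_logb_of_asymptoticRank_le {e h l : ℕ} {I : Finset (Fin e × Fin h)}
    {J : Finset (Fin h × Fin l)} (hf : 2 ≤ filling e h l I J) {ρ : ℝ}
    (hρ : asymptoticRank (partialMatMulTensor K e h l I J) ≤ ρ) :
    omega K ≤ 3 * Real.logb (filling e h l I J) ρ := by
  have key := (filling_rpow_le_asymptoticRank K e h l I J).trans hρ
  have hf' : (1 : ℝ) < filling e h l I J := by exact_mod_cast hf
  have hfpos : (0 : ℝ) < filling e h l I J := by linarith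
  have hlogf : 0 < Real.log (filling e h l I J) := Real.log_pos hf'
  have hlog := Real.log_le_log (Real.rpow_pos_of_pos hfpos _) key
  rw [Real.log_rpow hfpos] at hlog
  have h2 : omega K / 3 ≤ Real.log ρ / Real.log (filling e h l I J) := (le_div_iff₀ hlogf).2 hlog
  rw [Real.logb]
  linarith

omit [Infinite K] in
/-- **The pattern is a restriction of the total product**: `⟨e,h,l⟩ ≥ ⟨e,h,l⟩_{I,J}` (zero out the
`X`-variables outside `I` and the `Y`-variables outside `J`). [cite: BurgisserClausenShokrollahi1997, §15.9] -/
theorem tensorRestrictsTo_matMulTensor_partialMatMulTensor (e h l : ℕ)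
    (I : Finset (Fin e × Fin h)) (J : Finset (Fin h × Fin l)) :
    TensorRestrictsTo (matMulTensor K e h l) (partialMatMulTensor K e h l I J) := by
  classical
  refine ⟨fun a' a => if a' = a then 1 else 0, fun b' b => if b' = b ∧ b ∈ I then 1 else 0,
    fun c' c => if c' = c ∧ c ∈ J then 1 else 0, fun a' b' c' => ?_⟩
  rw [Finset.sum_eq_single a' (fun a _ ha => by simp [Ne.symm ha]) (by simp),
    Finset.sum_eq_single b' (fun b _ hb => by simp [Ne.symm hb]) (by simp),
    Finset.sum_eq_single c' (fun c _ hc => by simp [Ne.symm hc]) (by simp)]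
  unfold partialMatMulTensor
  by_cases hb : b' ∈ I <;> by_cases hc : c' ∈ J <;> simp [hb, hc]

omit [Infinite K] in
/-- Hence **`R̃(⟨k,k,k⟩_{I,J}) ≤ k^ω`** (`R̃(⟨k,k,k⟩) = k^ω`, `asymptoticRank_matMulTensor`).
[cite: AlmanDuanVassilevskaWilliamsXuXuZhou2025, §3.4] -/
theorem asymptoticRank_partialMatMulTensor_le_rpow_omega {k : ℕ} (hk : 1 ≤ k)
    (I J : Finset (Fin k × Fin k)) :
    asymptoticRank (partialMatMulTensor K k k k I J) ≤ (k : ℝ) ^ omega K :=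
  (asymptoticRank_le_of_polyDegeneratesTo
    (tensorRestrictsTo_matMulTensor_partialMatMulTensor K k k k I J).polyDegeneratesTo).trans
    (asymptoticRank_matMulTensor_le_rpow_omega K k hk)

end Asymptotic

/-! ## Dual pairs on a subset: a flattening lower bound for padded tensors -/

section DualPairs

variable {K : Type} [Field K] {ι κ μ : Type} [Fintype ι] [Fintype κ] [Fintype μ] [DecidableEq ι]

/-- If every `x`-slice indexed by `o ∈ S` has an entry `(P o, Q o)` where it alone (among ALL
slices) is nonzero, normalised to `1`, then the slices over `S` are linearly independent, so
`|S| ≤ ζ⁽¹⁾(t) ≤ R̃(t)`. [cite: Blaser2013, Lemma 7.1 (2) (proof)] -/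
theorem card_le_asymptoticRank_of_dualPairsOn (t : ι → κ → μ → K) (S : Finset ι) (P : ι → κ)
    (Q : ι → μ) (h : ∀ o ∈ S, ∀ o', t o' (P o) (Q o) = if o' = o then 1 else 0) :
    (S.card : ℝ) ≤ asymptoticRank t := by
  classical
  have hli : LinearIndependent K (fun o : S => xSlices t (o : ι)) := by
    rw [Fintype.linearIndependent_iff]
    intro g hg o
    have key := congrFun hg (P o, Q o)
    rw [Finset.sum_apply, Pi.zero_apply] at key
    simp only [Pi.smul_apply, xSlices_apply, smul_eq_mul, h o o.2] at key
    rw [Finset.sum_eq_single o (fun o' _ ho' => by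
      rw [if_neg (fun hh => ho' (Subtype.ext hh)), mul_zero]) (by simp)] at key
    simpa using key
  have h1 : Module.finrank K (Submodule.span K (Set.range fun o : S => xSlices t (o : ι))) =
      S.card := by
    rw [finrank_span_eq_card hli, Fintype.card_coe]
  have h2 : Module.finrank K (Submodule.span K (Set.range fun o : S => xSlices t (o : ι))) ≤
      flatteningRank t := by
    unfold flatteningRank
    exact Submodule.finrank_mono (Submodule.span_mono (by rintro _ ⟨o, rfl⟩; exact ⟨o, rfl⟩))
  have h3 : (S.card : ℝ) ≤ flatteningRank t := by exact_mod_cast h1 ▸ h2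
  exact h3.trans (flatteningRank_le_asymptoticRank t)

end DualPairs

end Summit.MatrixMultiplication.MatrixMultiplication.Theorems

end
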